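import Summits.AtomisticToContinuum.FouriersLaw.Theorems.PhononMeanFreePathIncoherentChannelSemigroupBudget
import Summits.AtomisticToContinuum.FouriersLaw.Theorems.PhononMeanFreePathIncoherentChannelCommonPastBudget

/-!
# `IncoherentChannel`, line `two-horizons-forecast-loss` — the TAIL budget of the coherent channel and the echo

Helper file for crux `PhononMeanFreePath.IncoherentChannel` (item stmt-AtomisticToContinuum-11811, route
`PhononMeanFreePath`, sub-problem `FouriersLaw`), registered stub `forecastBudget_tail`. For the `(N+1)`-site
pinned anharmonic chain `P = pinnedChain ω₂ lam β γ` with both Langevin baths at `T` write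
`μ₀ = P.gibbsMeasure (N+1) T`, `K_s = P.transitionKernel (N+1) T T s⁺`, `v_t = fcast … N t = K_t p_N` (mean
forecast of the far momentum), `S_N(t) = fnorm … N t = ‖v_t‖²_{L²(μ₀)}`, `r_N(t) = pairCorr … N t = ⟨p_0, v_t⟩_{μ₀}`
and the echo `a_N(t) = ⟨p_N, v_t⟩_{μ₀}` (`Theorems/PhononMeanFreePathDefs`).

The tree has the time-resolved forecast budget on `L²(μ₀)` (`forecastBudget_timeResolved_of_sq_integrable'`,
file `…IncoherentChannelSemigroupBudget`): for measurable square-integrable `F` and `t > 0`,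

  `‖K_t F‖² + (2γ/T) ∫_{0<s≤t} [⟨p_0, K_s F⟩² + ⟨p_N, K_s F⟩²] ds ≤ ∫ F² dμ₀`.

This file proves the TAIL BUDGET from any start time `t₁ ≥ 0` (`forecastBudget_tail`, registered signature):

  `(2γ/T) ∫_{s > t₁} (r_N(s)² + a_N(s)²) ds ≤ S_N(t₁)`.

Route: apply the `L²` budget to `F = v_{t₁}` (measurable and square-integrable, `lightCone_fcast_moments`);
by Chapman–Kolmogorov `K_s v_{t₁} = v_{s+t₁}` pointwise (`timeReversal_fcast_add`), so the two correlations are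
`r_N(s+t₁)`, `a_N(s+t₁)` and `∫ F² dμ₀ = S_N(t₁)`; drop the (nonnegative) forecast-norm term, let the horizon
`t → ∞` along `(0, n+1] ↑ (0, ∞)` (`commonPastBudget_iUnion_Ioc_nat_succ`, `setLIntegral_iUnion_of_directed`),
translate `s ↦ s + t₁` (Lebesgue measure is translation invariant) and convert the lower integral of the
nonnegative integrable function `r_N² + a_N²` (`rN_sq_integrableOn`, `aN_sq_integrableOn`) into its Bochner
integral.
No definitions; nothing here closes an item.
-/

noncomputable section

namespace Summit.AtomisticToContinuum.FouriersLaw.Theorems.PhononMeanFreePath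

open MeasureTheory ProbabilityTheory Set Filter Topology
open scoped NNReal ENNReal
open Literature.MathematicalPhysics.KineticTheory.HeatConduction
open Literature.MathematicalPhysics.KineticTheory Literature.Probability.Process OscillatorChain
open Summit.AtomisticToContinuum.FouriersLaw.Theorems.IncoherentBounded (rN_sq_integrableOn)

/-! ### A measure-theoretic tool on the time axis -/

/-- **Translation of a lower integral over a half-line**: `∫⁻_{s>0} g(s + t₁) ds = ∫⁻_{u>t₁} g(u) du`
(Lebesgue measure is invariant under `s ↦ s + t₁`, a measurable embedding with `(· + t₁)⁻¹' (t₁,∞) = (0,∞)`;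
no measurability of `g` is needed). [folklore] -/
theorem tailBudget_setLIntegral_Ioi_comp_add_right (g : ℝ → ℝ≥0∞) (t₁ : ℝ) :
    ∫⁻ s in Ioi (0 : ℝ), g (s + t₁) = ∫⁻ u in Ioi t₁, g u := by
  have h := (measurePreserving_add_right (volume : Measure ℝ) t₁).setLIntegral_comp_preimage_emb
    (measurableEmbedding_addRight t₁) g (Ioi t₁)
  rwa [preimage_add_const_Ioi, sub_self] at h

/-! ### The tail budget in lower-integral form -/

section Setting

variable {ω₂ lam β γ : ℝ} (hω : 0 < ω₂) (hl : 0 ≤ lam) (hβ : 0 < β) (hγ : 0 < γ) {T : ℝ} (hT : 0 < T) (N : ℕ)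
include hω hl hβ hγ hT

/-- **Finite-horizon shifted budget.** For `t₁ ≥ 0` and a horizon `t > 0`,

  `(2γ/T) ∫⁻_{0<s≤t} (r_N(s+t₁)² + a_N(s+t₁)²) ds ≤ S_N(t₁)`  (in `ℝ≥0∞`):

the `L²(μ₀)` budget `forecastBudget_timeResolved_of_sq_integrable'` at `F = v_{t₁}`, Chapman–Kolmogorov
`K_s v_{t₁} = v_{s+t₁}` (`timeReversal_fcast_add`) inside both correlations, and the forecast-norm term dropped.
[folklore] -/
theorem tailBudget_lintegral_Ioc_le {t₁ : ℝ} (ht₁ : 0 ≤ t₁) {t : ℝ} (ht : 0 < t) :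
    ENNReal.ofReal (2 * γ / T) * ∫⁻ s in Ioc (0 : ℝ) t,
      (ENNReal.ofReal ((pairCorr ω₂ lam β γ T N (s + t₁)) ^ 2) +
        ENNReal.ofReal ((∫ z, z.2 (Fin.last N) * fcast ω₂ lam β γ T N (s + t₁) z
          ∂((pinnedChain ω₂ lam β γ).gibbsMeasure (N + 1) T)) ^ 2)) ≤
      ENNReal.ofReal (fnorm ω₂ lam β γ T N t₁) := by
  have hFm : Measurable (fcast ω₂ lam β γ T N t₁) := lightCone_measurable_fcast ω₂ lam β γ T N t₁
  have hF2 : Integrable (fun z => fcast ω₂ lam β γ T N t₁ z ^ 2) ((pinnedChain ω₂ lam β γ).gibbsMeasure (N + 1) T) :=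
    (lightCone_fcast_moments ω₂ lam β γ hω hl hβ.le hγ.le T hT N t₁).2.1
  have hbud := forecastBudget_timeResolved_of_sq_integrable' hω hl hβ hγ hT N hFm hF2 ht
  -- Chapman–Kolmogorov inside both correlations, for `0 < s ≤ t`
  have hCK : ∀ s ∈ Ioc (0 : ℝ) t, ∀ x : PhaseSpace (N + 1),
      ∫ y, fcast ω₂ lam β γ T N t₁ y ∂((pinnedChain ω₂ lam β γ).transitionKernel (N + 1) T T s.toNNReal x) =
        fcast ω₂ lam β γ T N (s + t₁) x :=
    fun s hs x => (timeReversal_fcast_add hω hl hβ.le hγ.le hT N hs.1.le ht₁ x).symm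
  have heq : ∫⁻ s in Ioc (0 : ℝ) t, (ENNReal.ofReal ((∫ x, x.2 0 *
        (∫ y, fcast ω₂ lam β γ T N t₁ y ∂((pinnedChain ω₂ lam β γ).transitionKernel (N + 1) T T s.toNNReal x))
          ∂((pinnedChain ω₂ lam β γ).gibbsMeasure (N + 1) T)) ^ 2) +
      ENNReal.ofReal ((∫ x, x.2 (Fin.last N) *
        (∫ y, fcast ω₂ lam β γ T N t₁ y ∂((pinnedChain ω₂ lam β γ).transitionKernel (N + 1) T T s.toNNReal x))
          ∂((pinnedChain ω₂ lam β γ).gibbsMeasure (N + 1) T)) ^ 2)) =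
      ∫⁻ s in Ioc (0 : ℝ) t, (ENNReal.ofReal ((pairCorr ω₂ lam β γ T N (s + t₁)) ^ 2) +
        ENNReal.ofReal ((∫ z, z.2 (Fin.last N) * fcast ω₂ lam β γ T N (s + t₁) z
          ∂((pinnedChain ω₂ lam β γ).gibbsMeasure (N + 1) T)) ^ 2)) := by
    refine setLIntegral_congr_fun measurableSet_Ioc fun s hs => ?_
    simp only [hCK s hs, pairCorr]
  calc ENNReal.ofReal (2 * γ / T) * ∫⁻ s in Ioc (0 : ℝ) t,
        (ENNReal.ofReal ((pairCorr ω₂ lam β γ T N (s + t₁)) ^ 2) +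
          ENNReal.ofReal ((∫ z, z.2 (Fin.last N) * fcast ω₂ lam β γ T N (s + t₁) z
            ∂((pinnedChain ω₂ lam β γ).gibbsMeasure (N + 1) T)) ^ 2))
      = ENNReal.ofReal (2 * γ / T) * ∫⁻ s in Ioc (0 : ℝ) t, (ENNReal.ofReal ((∫ x, x.2 0 *
          (∫ y, fcast ω₂ lam β γ T N t₁ y ∂((pinnedChain ω₂ lam β γ).transitionKernel (N + 1) T T s.toNNReal x))
            ∂((pinnedChain ω₂ lam β γ).gibbsMeasure (N + 1) T)) ^ 2) +
        ENNReal.ofReal ((∫ x, x.2 (Fin.last N) *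
          (∫ y, fcast ω₂ lam β γ T N t₁ y ∂((pinnedChain ω₂ lam β γ).transitionKernel (N + 1) T T s.toNNReal x))
            ∂((pinnedChain ω₂ lam β γ).gibbsMeasure (N + 1) T)) ^ 2)) := by rw [heq]
    _ ≤ ENNReal.ofReal (∫ x, (∫ y, fcast ω₂ lam β γ T N t₁ y
          ∂((pinnedChain ω₂ lam β γ).transitionKernel (N + 1) T T t.toNNReal x)) ^ 2
            ∂((pinnedChain ω₂ lam β γ).gibbsMeasure (N + 1) T)) +
        ENNReal.ofReal (2 * γ / T) * ∫⁻ s in Ioc (0 : ℝ) t, (ENNReal.ofReal ((∫ x, x.2 0 *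
          (∫ y, fcast ω₂ lam β γ T N t₁ y ∂((pinnedChain ω₂ lam β γ).transitionKernel (N + 1) T T s.toNNReal x))
            ∂((pinnedChain ω₂ lam β γ).gibbsMeasure (N + 1) T)) ^ 2) +
        ENNReal.ofReal ((∫ x, x.2 (Fin.last N) *
          (∫ y, fcast ω₂ lam β γ T N t₁ y ∂((pinnedChain ω₂ lam β γ).transitionKernel (N + 1) T T s.toNNReal x))
            ∂((pinnedChain ω₂ lam β γ).gibbsMeasure (N + 1) T)) ^ 2)) := le_add_self
    _ ≤ ENNReal.ofReal (∫ x, fcast ω₂ lam β γ T N t₁ x ^ 2 ∂((pinnedChain ω₂ lam β γ).gibbsMeasure (N + 1) T)) :=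
        hbud
    _ = ENNReal.ofReal (fnorm ω₂ lam β γ T N t₁) := rfl

/-- **Infinite-horizon shifted budget.** For `t₁ ≥ 0`,

  `(2γ/T) ∫⁻_{s>0} (r_N(s+t₁)² + a_N(s+t₁)²) ds ≤ S_N(t₁)`  (in `ℝ≥0∞`):

`(0,∞) = ⋃ₙ (0, n+1]` (`commonPastBudget_iUnion_Ioc_nat_succ`) is a directed union, so the lower integral over
`(0,∞)` is the supremum of the finite-horizon ones (`setLIntegral_iUnion_of_directed`), each bounded by
`tailBudget_lintegral_Ioc_le`. [folklore] -/
theorem tailBudget_lintegral_Ioi_le {t₁ : ℝ} (ht₁ : 0 ≤ t₁) :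
    ENNReal.ofReal (2 * γ / T) * ∫⁻ s in Ioi (0 : ℝ),
      (ENNReal.ofReal ((pairCorr ω₂ lam β γ T N (s + t₁)) ^ 2) +
        ENNReal.ofReal ((∫ z, z.2 (Fin.last N) * fcast ω₂ lam β γ T N (s + t₁) z
          ∂((pinnedChain ω₂ lam β γ).gibbsMeasure (N + 1) T)) ^ 2)) ≤
      ENNReal.ofReal (fnorm ω₂ lam β γ T N t₁) := by
  have hdir : Directed (· ⊆ ·) fun n : ℕ => Ioc (0 : ℝ) ((n : ℝ) + 1) :=
    directed_of_isDirected_le fun m n hmn => Ioc_subset_Ioc_right (add_le_add_left (Nat.cast_le.mpr hmn) 1)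
  rw [← commonPastBudget_iUnion_Ioc_nat_succ, setLIntegral_iUnion_of_directed _ hdir, ENNReal.mul_iSup]
  exact iSup_le fun n => tailBudget_lintegral_Ioc_le hω hl hβ hγ hT N ht₁ (by positivity)

end Setting

/-! ### The registered stub -/

/-- **THE TAIL BUDGET OF THE COHERENT CHANNEL AND THE ECHO** (registered stub `forecastBudget_tail` of line
`two-horizons-forecast-loss`): for the pinned anharmonic chain (`ω₂, β, γ > 0`, `lam ≥ 0`) with both baths at
`T > 0`, EVERY `N` and every start time `t₁ ≥ 0`,

  `(2γ/T) ∫_{s > t₁} (r_N(s)² + a_N(s)²) ds ≤ S_N(t₁)`,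

`r_N = pairCorr` the route's coherent channel, `a_N(s) = ⟨p_N, v_s⟩_{μ₀}` the echo, `S_N = fnorm` the forecast
norm: the time-resolved `L²(μ₀)` budget applied to `F = v_{t₁}` (Chapman–Kolmogorov `K_s v_{t₁} = v_{s+t₁}`),
horizon `t → ∞`, translation `s ↦ s + t₁`, and the lower integral of the nonnegative integrable `r_N² + a_N²`
converted into its Bochner integral. [folklore] -/
theorem forecastBudget_tail : ∀ ω₂ lam β γ : ℝ, 0 < ω₂ → 0 ≤ lam → 0 < β → 0 < γ → ∀ T : ℝ, 0 < T → ∀ (N : ℕ) (t₁ : ℝ), 0 ≤ t₁ → (2 * γ / T) * ∫ s in Ioi t₁, ((pairCorr ω₂ lam β γ T N s) ^ 2 + (∫ z, z.2 (Fin.last N) * fcast ω₂ lam β γ T N s z ∂((pinnedChain ω₂ lam β γ).gibbsMeasure (N + 1) T)) ^ 2) ≤ fnorm ω₂ lam β γ T N t₁ := by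
  intro ω₂ lam β γ hω hl hβ hγ T hT N t₁ ht₁
  -- integrability and nonnegativity of `r_N² + a_N²` on `(t₁, ∞)`
  have hr : IntegrableOn (fun s => (pairCorr ω₂ lam β γ T N s) ^ 2) (Ioi t₁) :=
    (rN_sq_integrableOn hω hl hβ hγ hT N).mono_set (Ioi_subset_Ioi ht₁)
  have ha : IntegrableOn (fun s => (∫ z, z.2 (Fin.last N) * fcast ω₂ lam β γ T N s z
      ∂((pinnedChain ω₂ lam β γ).gibbsMeasure (N + 1) T)) ^ 2) (Ioi t₁) :=
    (aN_sq_integrableOn hω hl hβ hγ hT N).mono_set (Ioi_subset_Ioi ht₁)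
  have hi := hr.add ha
  have h0 : 0 ≤ᵐ[volume.restrict (Ioi t₁)] fun s => (pairCorr ω₂ lam β γ T N s) ^ 2 +
      (∫ z, z.2 (Fin.last N) * fcast ω₂ lam β γ T N s z ∂((pinnedChain ω₂ lam β γ).gibbsMeasure (N + 1) T)) ^ 2 :=
    Eventually.of_forall fun s => add_nonneg (sq_nonneg _) (sq_nonneg _)
  -- the budget in `ℝ≥0∞`, translated to `(t₁, ∞)`
  have hL := tailBudget_lintegral_Ioi_le hω hl hβ hγ hT N ht₁
  rw [tailBudget_setLIntegral_Ioi_comp_add_right (fun u => ENNReal.ofReal ((pairCorr ω₂ lam β γ T N u) ^ 2) +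
    ENNReal.ofReal ((∫ z, z.2 (Fin.last N) * fcast ω₂ lam β γ T N u z
      ∂((pinnedChain ω₂ lam β γ).gibbsMeasure (N + 1) T)) ^ 2)) t₁] at hL
  have hL' : ENNReal.ofReal (2 * γ / T) * ∫⁻ s in Ioi t₁, ENNReal.ofReal ((pairCorr ω₂ lam β γ T N s) ^ 2 +
      (∫ z, z.2 (Fin.last N) * fcast ω₂ lam β γ T N s z ∂((pinnedChain ω₂ lam β γ).gibbsMeasure (N + 1) T)) ^ 2) ≤
      ENNReal.ofReal (fnorm ω₂ lam β γ T N t₁) := by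
    refine le_trans (le_of_eq ?_) hL
    congr 1
    exact lintegral_congr fun s => ENNReal.ofReal_add (sq_nonneg _) (sq_nonneg _)
  -- back to the Bochner integral
  have hc : 0 ≤ 2 * γ / T := by positivity
  calc (2 * γ / T) * ∫ s in Ioi t₁, ((pairCorr ω₂ lam β γ T N s) ^ 2 +
        (∫ z, z.2 (Fin.last N) * fcast ω₂ lam β γ T N s z ∂((pinnedChain ω₂ lam β γ).gibbsMeasure (N + 1) T)) ^ 2)
      = (2 * γ / T) * (∫⁻ s in Ioi t₁, ENNReal.ofReal ((pairCorr ω₂ lam β γ T N s) ^ 2 +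
          (∫ z, z.2 (Fin.last N) * fcast ω₂ lam β γ T N s z
            ∂((pinnedChain ω₂ lam β γ).gibbsMeasure (N + 1) T)) ^ 2)).toReal := by
        rw [integral_eq_lintegral_of_nonneg_ae h0 hi.aestronglyMeasurable]
    _ = (ENNReal.ofReal (2 * γ / T) * ∫⁻ s in Ioi t₁, ENNReal.ofReal ((pairCorr ω₂ lam β γ T N s) ^ 2 +
          (∫ z, z.2 (Fin.last N) * fcast ω₂ lam β γ T N s z
            ∂((pinnedChain ω₂ lam β γ).gibbsMeasure (N + 1) T)) ^ 2)).toReal := by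
        rw [ENNReal.toReal_mul, ENNReal.toReal_ofReal hc]
    _ ≤ fnorm ω₂ lam β γ T N t₁ := ENNReal.toReal_le_of_le_ofReal (fnorm_nonneg ω₂ lam β γ T N t₁) hL'

end Summit.AtomisticToContinuum.FouriersLaw.Theorems.PhononMeanFreePath

end
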